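import Summits.MatrixMultiplication.MatrixMultiplication.Theorems.SoloInformedValFullRowOwnership

/-!
# Full-row designs with four rows: the block injection and the grid label bound for `K_{4,2}`
(solo-informed gen 92, CLAIMS c723; dossier `work/g87/cyc/CYC.md` §13(g9))

For a full-row design (`FullRowDesign`, see `SoloInformedValFullRowOwnership`) whose row type is exhausted by four rows
`p₀, p₁, p₂, p₃` and which has two distinct columns `m ≠ n`, put `d₁ = e (p₀,m) + e (p₁,n)` and `d₂ = e (p₂,m) + e (p₃,n)`.

BLOCK LEMMA (`not_both`).  No typed point `P` has both `P + d₁` and `P + d₂` typed: the two-cell differences `d₁`, `d₂` lie in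
two distinct columns, so the rule `FRAllowed` forces the type of `P` to avoid `{p₀,p₁}` and `{p₂,p₃}`, i.e. every row.

BLOCK INJECTION (`four_rows_bound`).  `P ↦ P + d₁` if that point is untyped, else `P ↦ P + d₂`, maps the typed points
injectively into the untyped even points (a collision `P + d₂ = P' + d₁` would make `P + d₁` a typed point with both
translates typed).  Hence `2 · Σ_r |S r| ≤ #even points ≤ |G| / 2`, i.e. `4 · Σ_r |S r| ≤ |G|`.

For the grid `F_2^{4 × c}` (`c ≥ 2`) this is `Σ_r |S r| ≤ 2^{4c-2}` (`grid_fullRow_four_rows`); for `c = 2` it is the grid label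
bound `2 · c · Σ_r |S r| ≤ 2^{ac}` of the `K_{4,2}` full-row family, `Σ_r |S r| ≤ 64` (`grid_fullRow_bound_four_two`), previously
certified only by SAT (+DRAT).  Equivalently: the even points split into the 32 cosets of `{0, d₁, d₂, d₁+d₂}`, labelled 4-cycles
on which no three points can be typed.
-/

namespace Summit.MatrixMultiplication.MatrixMultiplication.Theorems.SoloVal

open Finset

section Block

variable {G : Type*} [AddCommGroup G]
variable {R C : Type*}
variable {e : R × C → G} (D : FullRowDesign e)

/-- BLOCK LEMMA.  With the rows exhausted by `p₀,p₁,p₂,p₃` and columns `m ≠ n`: a point of type `t` cannot have both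
`P + (e (p₀,m) + e (p₁,n))` and `P + (e (p₂,m) + e (p₃,n))` typed. -/
theorem FullRowDesign.not_both (h2 : ∀ g : G, g + g = 0) {p₀ p₁ p₂ p₃ : R}
    (hcov : ∀ r : R, r = p₀ ∨ r = p₁ ∨ r = p₂ ∨ r = p₃) {m n : C} (hmn : m ≠ n)
    {P : G} {t q₁ q₂ : R} (hP : P ∈ D.S t)
    (hq₁ : P + (e (p₀, m) + e (p₁, n)) ∈ D.S q₁) (hq₂ : P + (e (p₂, m) + e (p₃, n)) ∈ D.S q₂) : False := by
  have hne₁ : ((p₀, m) : R × C) ≠ (p₁, n) := fun h => hmn (congrArg Prod.snd h)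
  have hne₂ : ((p₂, m) : R × C) ≠ (p₃, n) := fun h => hmn (congrArg Prod.snd h)
  have hs₁ : P + (P + (e (p₀, m) + e (p₁, n))) = e (p₀, m) + e (p₁, n) := by rw [← add_assoc, h2 P, zero_add]
  have hs₂ : P + (P + (e (p₂, m) + e (p₃, n))) = e (p₂, m) + e (p₃, n) := by rw [← add_assoc, h2 P, zero_add]
  have c₁ := D.cond t q₁ P hP _ hq₁ (p₀, m) (p₁, n) hne₁ hs₁
  have c₂ := D.cond t q₂ P hP _ hq₂ (p₂, m) (p₃, n) hne₂ hs₂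
  rcases c₁ with ⟨a₀, -, a₁, -⟩ | ⟨-, hm, -⟩
  · rcases c₂ with ⟨a₂, -, a₃, -⟩ | ⟨-, hm, -⟩
    · rcases hcov t with h | h | h | h
      · exact a₀ h.symm
      · exact a₁ h.symm
      · exact a₂ h.symm
      · exact a₃ h.symm
    · exact hmn hm
  · exact hmn hm

variable [Fintype R] [DecidableEq G]

/-- Membership in the typed points `univ.biUnion D.S`. -/
theorem FullRowDesign.mem_typed {X : G} : X ∈ (univ : Finset R).biUnion D.S ↔ ∃ r, X ∈ D.S r := by
  simp

/-- The number of typed points is `Σ_r |S r|` (distinct types are disjoint). -/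
theorem FullRowDesign.card_typed : ((univ : Finset R).biUnion D.S).card = ∑ r, (D.S r).card := by
  rw [card_biUnion]
  intro p _ q _ hpq
  exact disjoint_left.2 (fun X hXp hXq => D.disj p q hpq X hXp hXq)

/-- BLOCK INJECTION THEOREM (four rows, two distinct columns).  `4 · Σ_r |S r| ≤ |G|` for a full-row design on even points of
an exponent-two group with parity character `π` (`π (e t) = 1`) whose rows are exhausted by `p₀,p₁,p₂,p₃`. -/
theorem FullRowDesign.four_rows_bound [Fintype G] (h2 : ∀ g : G, g + g = 0)
    (π : G →+ ZMod 2) (hπ : ∀ t, π (e t) = 1) (hS : ∀ r, ∀ X ∈ D.S r, π X = 0)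
    {p₀ p₁ p₂ p₃ : R} (hcov : ∀ r : R, r = p₀ ∨ r = p₁ ∨ r = p₂ ∨ r = p₃) {m n : C} (hmn : m ≠ n) :
    4 * ∑ r, (D.S r).card ≤ Fintype.card G := by
  classical
  set d₁ : G := e (p₀, m) + e (p₁, n) with hd₁
  set d₂ : G := e (p₂, m) + e (p₃, n) with hd₂
  set T : Finset G := (univ : Finset R).biUnion D.S with hT
  set E : Finset G := univ.filter (fun g => π g = 0) with hE
  have h11 : (1 : ZMod 2) + 1 = 0 := by decide
  have hπd₁ : π d₁ = 0 := by rw [hd₁, map_add, hπ, hπ, h11]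
  have hπd₂ : π d₂ = 0 := by rw [hd₂, map_add, hπ, hπ, h11]
  have hTE : T ⊆ E := by
    intro X hX
    obtain ⟨r, hr⟩ := D.mem_typed.1 hX
    exact mem_filter.2 ⟨mem_univ _, hS r X hr⟩
  -- the block lemma in `T`-language
  have key : ∀ P ∈ T, P + d₁ ∈ T → P + d₂ ∈ T → False := by
    intro P hP h₁ h₂
    obtain ⟨t, ht⟩ := D.mem_typed.1 hP
    obtain ⟨q₁, hq₁⟩ := D.mem_typed.1 h₁
    obtain ⟨q₂, hq₂⟩ := D.mem_typed.1 h₂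
    exact D.not_both h2 hcov hmn ht hq₁ hq₂
  -- the injection
  let φ : G → G := fun P => if P + d₁ ∈ T then P + d₂ else P + d₁
  have hφmem : ∀ P ∈ T, φ P ∈ E \ T := by
    intro P hP
    have hPE : π P = 0 := (mem_filter.1 (hTE hP)).2
    by_cases h₁ : P + d₁ ∈ T
    · have hφ : φ P = P + d₂ := if_pos h₁
      rw [hφ, mem_sdiff]
      exact ⟨mem_filter.2 ⟨mem_univ _, by rw [map_add, hPE, hπd₂, zero_add]⟩, fun h₂ => key P hP h₁ h₂⟩
    · have hφ : φ P = P + d₁ := if_neg h₁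
      rw [hφ, mem_sdiff]
      exact ⟨mem_filter.2 ⟨mem_univ _, by rw [map_add, hPE, hπd₁, zero_add]⟩, h₁⟩
  have hφinj : Set.InjOn φ T := by
    intro P hP P' hP' hPP'
    have hP : P ∈ T := hP
    have hP' : P' ∈ T := hP'
    by_cases h₁ : P + d₁ ∈ T
    · by_cases h₁' : P' + d₁ ∈ T
      · have h : P + d₂ = P' + d₂ := by
          have := hPP'; simp only [φ, if_pos h₁, if_pos h₁'] at this; exact this
        exact add_right_cancel h
      · have h : P + d₂ = P' + d₁ := by
          have := hPP'; simp only [φ, if_pos h₁, if_neg h₁'] at this; exact this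
        -- Q = P + d₁ is typed with Q + d₁ = P and Q + d₂ = P' typed
        exfalso
        refine key (P + d₁) h₁ ?_ ?_
        · rw [add_assoc, h2 d₁, add_zero]; exact hP
        · have : P + d₁ + d₂ = P' := by
            rw [add_assoc, add_comm d₁ d₂, ← add_assoc, h, add_assoc, h2 d₁, add_zero]
          rw [this]; exact hP'
    · by_cases h₁' : P' + d₁ ∈ T
      · have h : P + d₁ = P' + d₂ := by
          have := hPP'; simp only [φ, if_neg h₁, if_pos h₁'] at this; exact this
        exfalso
        refine key (P' + d₁) h₁' ?_ ?_
        · rw [add_assoc, h2 d₁, add_zero]; exact hP'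
        · have : P' + d₁ + d₂ = P := by
            rw [add_assoc, add_comm d₁ d₂, ← add_assoc, ← h, add_assoc, h2 d₁, add_zero]
          rw [this]; exact hP
      · have h : P + d₁ = P' + d₁ := by
          have := hPP'; simp only [φ, if_neg h₁, if_neg h₁'] at this; exact this
        exact add_right_cancel h
  have hcard₁ : T.card ≤ (E \ T).card := card_le_card_of_injOn φ hφmem hφinj
  have hcard₂ : (E \ T).card + T.card = E.card := card_sdiff_add_card_eq_card hTE
  -- the even points are at most half of `G`
  have hEG : 2 * E.card ≤ Fintype.card G := by
    set Odd : Finset G := univ.filter (fun U => π U = 1) with hOdd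
    have hEO : E.card ≤ Odd.card := by
      apply card_le_card_of_injOn (fun U => U + e (p₀, m))
      · intro U hU
        have h0 : π U = 0 := (mem_filter.1 hU).2
        refine mem_filter.2 ⟨mem_univ _, ?_⟩
        rw [map_add, hπ, h0, zero_add]
      · intro U _ U' _ h; exact add_right_cancel h
    have hdisj : Disjoint Odd E := by
      rw [hOdd, hE, disjoint_filter]; intro U _ h1 h0; rw [h1] at h0; exact absurd h0 (by decide)
    have hle : (Odd ∪ E).card ≤ Fintype.card G := card_le_univ _
    rw [card_union_of_disjoint hdisj] at hle
    omega
  rw [← D.card_typed, ← hT]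
  omega

end Block

section Grid

/-- THE FULL-ROW GRID BOUND FOR FOUR ROWS FROM THE BLOCK INJECTION.  On the grid `F_2^{4 × c}` with `c ≥ 2`, cell vectors the
standard basis, every full-row design on even points satisfies `4 · Σ_r |S r| ≤ 2^{4c}`, i.e. `Σ_r |S r| ≤ 2^{4c-2}`. -/
theorem grid_fullRow_four_rows {c : ℕ} (hc : 2 ≤ c)
    (D : FullRowDesign (fun t : Fin 4 × Fin c => (Pi.single t (1 : ZMod 2) : Fin 4 × Fin c → ZMod 2)))
    (hS : ∀ r, ∀ X ∈ D.S r, ∑ t, X t = 0) :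
    4 * ∑ r, (D.S r).card ≤ 2 ^ (4 * c) := by
  have h2 : ∀ g : Fin 4 × Fin c → ZMod 2, g + g = 0 := by
    intro g; funext t; simp only [Pi.add_apply, Pi.zero_apply]; generalize g t = z; revert z; decide
  have hπ : ∀ t : Fin 4 × Fin c, gridParity 4 c (Pi.single t 1) = 1 := by
    intro t; simp [gridParity]
  have hcov : ∀ r : Fin 4, r = 0 ∨ r = 1 ∨ r = 2 ∨ r = 3 := by decide
  have hmn : (⟨0, by omega⟩ : Fin c) ≠ ⟨1, by omega⟩ := by simp [Fin.ext_iff]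
  have h := D.four_rows_bound h2 (gridParity 4 c) hπ (fun r X hX => by simpa [gridParity] using hS r X hX) hcov hmn
  simpa [Fintype.card_pi, ZMod.card, Fintype.card_prod, Fintype.card_fin, prod_const, card_univ] using h

/-- THE GRID LABEL BOUND FOR THE `K_{4,2}` FULL-ROW FAMILY (`BOUND(4,2)`, value `≤ 64`): `2 · c · Σ_r |S r| ≤ 2^{a c}` with
`a = 4`, `c = 2` — the first case with four rows, where the odd-point ownership count of `SoloInformedValFullRowOwnership`
does not apply; proved by the block injection. -/
theorem grid_fullRow_bound_four_two
    (D : FullRowDesign (fun t : Fin 4 × Fin 2 => (Pi.single t (1 : ZMod 2) : Fin 4 × Fin 2 → ZMod 2)))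
    (hS : ∀ r, ∀ X ∈ D.S r, ∑ t, X t = 0) :
    2 * (2 * ∑ r, (D.S r).card) ≤ 2 ^ (4 * 2) := by
  have h := grid_fullRow_four_rows (le_refl 2) D hS
  omega

end Grid

end Summit.MatrixMultiplication.MatrixMultiplication.Theorems.SoloVal
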